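/-
Copyright (c) 2026 the pub-hodgecm-mathlib formalisation cell (harness21).  Prover seat hodgecm-mathlib-K2E4-p14 (g13), Track B ∕ K2-LIT, h413 = `stmt-HodgeConjecture-24833`,
R90-TF section S8 «ContSpec-n½», #4′ road, brick UB-STR-2 ≡ UB-SD-3 (S8 dealer R90-CS-plan (g4), S8-R261 (2), 2026-09-05T03:47:08Z): the structural binders `νinf νf μK χ₁ e` of
★ p865127 (self-dual (N_blk) at the top row) and ★ `R90S8ResHOffDualNoLineMassU2` §4 (off-dual) DISCHARGED.
-/
import Summits.HodgeConjecture.HodgeConjecture.Theorems.R90S8ResHSelfDualBlockIntertwiningU2     -- ★ p865127 (this seat): SD (N_blk) at the top row (brings ★ OD twin `R90S8ResHOffDualNoLineMassU2`)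
import Summits.HodgeConjecture.HodgeConjecture.Theorems.R90S8LevelIdempotentOfCompactOpenU       -- ★ (K2E1-p14 lineage): `exists_levelIdempotent`, `isCompact_maximalLevelFin`
import Summits.HodgeConjecture.HodgeConjecture.Theorems.R90S8ResGIsotypicDensityU3              -- ★ `compactSpace_arch_inf_unitaryOne` (`K_∞ ∩ U(1⊗1)` compact)
import Literature.NumberTheory.Rogawski1990.ArchCentralValueTransferExistsVacuous              -- ★ `exists_isHaarMeasure_isMulRightInvariant_arch` (arch unimodular)
import Literature.NumberTheory.Automorphic.UnitaryGroupOfLocalTorusMeasureOfUnimodular          -- ★ `isMulRightInvariant_finAdelic_of_adelic`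
import Literature.NumberTheory.Automorphic.AdelicUnitaryGroupUnimodularQuasiSplit              -- ★ `forall_isHaarMeasure_isMulRightInvariant_quasiSplit_cm_two`
import Literature.NumberTheory.Automorphic.GLnIwasawaIntegration                               -- ★ `isInvInvariant_of_isMulRightInvariant`
import Literature.NumberTheory.Automorphic.ClosedCompactDecomposition                          -- ★ `isMulRightInvariant_of_compactSpace`, `isInvInvariant_of_compactSpace`
import Literature.NumberTheory.Automorphic.UnitaryGroupAdelicProductHaar                       -- ★ `locallyCompactSpace_finAdelic`, `secondCountableTopology_finAdelic`, `t2Space_finAdelic`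
import Literature.AlgebraicGeometry.ShimuraVarieties.UnitaryBallAdelicLiftPetersson            -- ★ `locallyCompactSpace_arch`, `secondCountableTopology_arch`
import HarnessLib

/-!
# S8 #4′ road — `R90S8ResHBlocksNoLineMassTopOfRecordU2` (UB-STR-2 ≡ UB-SD-3): the TOP-ROW (N_blk) heads WITHOUT STRUCTURAL BINDERS — ★ p865127 (self-dual blocks, rung-1 model)
# and ★ `R90S8ResHOffDualNoLineMassU2` §4 (off-dual blocks) with `νinf νf μK χ₁ e he0 he1 heK hestar hχ1` INHABITED

Track B ∕ R90-TF, crux h413 = `stmt-HodgeConjecture-24833`, route of record `HCCMUnconditional`; cell `hodgecm-mathlib`, section S8 «ContSpec-n½», socket #4′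
`sock_S8_resH_spannedByCharLines`.  THEOREMS ONLY (no `def`, no `instance`, no `notation`, no named-fact hypothesis, no `sorry`); ★-only imports; lane
`--supports stmt-HodgeConjecture-24833 --as helper` (count-neutral).  CLOSES NO SOCKET (K2E3-p27 (g4)'s UB-PK-2 `rowBody_top` consumes the two heads; #4′ stays OPEN).

THE RECIPE (K2E3-p27 (g4)'s STR recipe of ★ p865119, E1 side).  Borel σ-algebras by `borel _`.  `νinf :=` a right-invariant Haar measure of `U(J₂)(L⁺ ⊗ ℝ)` (★
`exists_isHaarMeasure_isMulRightInvariant_arch`: reductive real groups are unimodular), inversion-invariant by ★ `isInvInvariant_of_isMulRightInvariant`, s-finite (σ-finite Haar on a second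
countable group); `νf := haar` on `U(J₂)(𝔸_{L⁺,f})`, right-invariant by ★ `isMulRightInvariant_finAdelic_of_adelic` ∘ ★ `forall_isHaarMeasure_isMulRightInvariant_quasiSplit_cm_two` (the adelic
group is unimodular), hence inversion-invariant; `μK :=` the normalised Haar measure of the COMPACT `K_∞ ∩ U(1⊗1)` (★ `compactSpace_arch_inf_unitaryOne`; right- and inversion-invariant by ★
`isMulRightInvariant_of_compactSpace` ∕ ★ `isInvInvariant_of_compactSpace`); `χ₁ := 1` (the constant compactly supported function); `e :=` the level idempotent `νf(K′_f)⁻¹·𝟙_{K′_f}` of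
the compact-open M1 finite level `GL₂(𝒪̂_L) ∩ U(J₂)(𝔸_f)` (★ `exists_levelIdempotent`, ★ `m1_level_witness`, ★ `isCompact_of_isOpen_of_le_maximalLevelFin`) with `he0 he1 heK hestar`.
* §1 **`exists_e1StructuralMeasures`** — LEVEL-FREE, for EVERY Borel structure: `νinf νf μK χ₁` with all their instance facts (+ `MeasurableMul`); the idempotent of any compact-open
  level `K′_f` is then ★ `exists_levelIdempotent νf` (K2E3-p27's UB-OD-1 at `Kad K′_f`).  **`exists_e1StructuralBinders_top`** — everything ∃-bound (Borel σ-algebras by `borel _`), `e` at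
  the M1 level `GL₂(𝒪̂_L) ∩ U(J₂)(𝔸_f)` with `he0 he1 heK hestar`, `hχ1`.
* §2 **`exists_blockModel_subrep_le_orthogonal_resHLine_selfDual_top_of_record`** — ★ p865127 §1 binder-free but for the block datum `(χ, hray, hsd, hne)`;
  **`exists_blockModel_resH_isotypic_le_orthogonal_lines_selfDual_top_of_record`** (★ p865127 §2, `hN` bytes with `𝔓`) and **`exists_blockModel_isotypic_le_orthogonal_resHLine_selfDual_top_of_record`**
  (the same RESIDUAL-FREE: no `𝔓`, no `W′ ≤ L²_res` premise); **`subrep_le_orthogonal_resHBlock_offDual_top_of_record`** — ★ OD §4 binder-free but for `(χ, hχu, hoff)`;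
  **`resH_isotypic_le_orthogonal_lines_offDual_top_of_record`** — ★ OD §4′ (`hN` bytes, every `U′`).
HONEST LABEL: HC_CM is proved only modulo the 7 printed citations (2 remaining named inputs: hLiu418 = `stmt-HodgeConjecture-24832`, h413 = `stmt-HodgeConjecture-24833`) until
rung 0 closes; REL ≠ ★ ≠ BUILT; this file asserts no named fact and closes no socket; count-neutral.

## References
* [MoeglinWaldspurger1995] C. Mœglin, J.-L. Waldspurger, *Spectral Decomposition and Eisenstein Series* (1995), II.2.4, IV.1.10, V.3.13, VI.2.
* [BorelJacquet1979] A. Borel, H. Jacquet, *Automorphic forms and automorphic representations*, PSPM 33.1 (1979), §4.1.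
* [Knapp2002] A. W. Knapp, *Lie Groups Beyond an Introduction*, 2nd ed. (2002), VIII §2 Cor. 8.31 (reductive groups are unimodular).
* [DeitmarEchterhoff2014] A. Deitmar, S. Echterhoff, *Principles of Harmonic Analysis*, 2nd ed. (2014), Prop. 9.1.5.
-/

set_option autoImplicit false
set_option linter.dupNamespace false  -- the mandated namespace `…HodgeConjecture.HodgeConjecture.R90.S8` (LEAD #1 L1) repeats the summit's segment

noncomputable section

open MeasureTheory MeasureTheory.Measure Filter Topology CompactlySupported NumberField NumberField.mixedEmbedding NumberField.InfinitePlace IsDedekindDomain Set Complex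
open scoped ENNReal NNReal ComplexConjugate InnerProductSpace
open Literature.NumberTheory Literature.NumberTheory.Automorphic Literature.NumberTheory.Automorphic.UnitaryGroup Literature.NumberTheory.GaloisRepresentations AdelicGroupData ContRepresentation
open Summit.HodgeConjecture.HodgeConjecture.Cruxes.H413.K2E1BorelEisensteinU
open Summit.HodgeConjecture.HodgeConjecture.Cruxes.H413.K2E1CharacterEisensteinU2Defs
open Summit.HodgeConjecture.HodgeConjecture.Cruxes.H413.K2E1ChiSectionSpaceU2Defs
open Summit.HodgeConjecture.HodgeConjecture.Cruxes.H413.K2E1CuspidalSpectrumUnitary (residualSubspace)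
open Summit.HodgeConjecture.HodgeConjecture.Cruxes.H413.K2E1ResidualBlockPackageOffDualM1CMTwo (m1_level_witness)

namespace Summit.HodgeConjecture.HodgeConjecture.R90.S8

variable (L : Type) [Field L] [NumberField L] [IsCMField L]
  (μ : Measure (quasiSplit (↥(maximalRealSubfield L)) L (IsCMField.complexConj L) 2).automorphicQuotient) [(quasiSplit (↥(maximalRealSubfield L)) L (IsCMField.complexConj L) 2).IsAutomorphicMeasure μ]

/-! ## §1 The E1-side structural measures (every Borel structure) and the top row's binders, inhabited -/

/-- **THE E1-SIDE STRUCTURAL MEASURES `νinf νf μK` (AND `χ₁ ≡ 1`) EXIST FOR EVERY BOREL STRUCTURE** on `U(J₂)(L⁺ ⊗ ℝ)`, `U(J₂)(𝔸_{L⁺,f})`, `K_∞ ∩ U(1⊗1)`: a Haar measure `νinf` which is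
inversion-invariant and s-finite (the real group is unimodular), a Haar measure `νf` which is right- and inversion-invariant (the finite-adelic group is unimodular, read off the adelic one),
the normalised bi-invariant Haar measure `μK` of the compact `K_∞ ∩ U(1⊗1)`, the constant `χ₁ ≡ 1`, and `MeasurableMul` of the finite-adelic group.  LEVEL-FREE: the level idempotent of ANY
compact-open level `K′_f` is then ★ `exists_levelIdempotent νf`. [cite: Knapp2002, VIII §2 Cor. 8.31] [cite: DeitmarEchterhoff2014, Prop. 9.1.5] [cite: BorelJacquet1979, §4.1] -/
theorem exists_e1StructuralMeasures [MeasurableSpace (UnitaryGroup.arch (↥(maximalRealSubfield L)) L (IsCMField.complexConj L) 2 ((StdForm.antidiagonal 2).over L))] [BorelSpace (UnitaryGroup.arch (↥(maximalRealSubfield L)) L (IsCMField.complexConj L) 2 ((StdForm.antidiagonal 2).over L))] [MeasurableSpace (finAdelic (↥(maximalRealSubfield L)) L (IsCMField.complexConj L) 2 ((StdForm.antidiagonal 2).over L))] [BorelSpace (finAdelic (↥(maximalRealSubfield L)) L (IsCMField.complexConj L) 2 ((StdForm.antidiagonal 2).over L))]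
    [MeasurableSpace ↥(UnitaryGroup.arch (↥(maximalRealSubfield L)) L (IsCMField.complexConj L) 2 ((StdForm.antidiagonal 2).over L) ⊓ unitaryGroupOfForm (conjMixed (↥(maximalRealSubfield L)) L (IsCMField.complexConj L)) 1)] [BorelSpace ↥(UnitaryGroup.arch (↥(maximalRealSubfield L)) L (IsCMField.complexConj L) 2 ((StdForm.antidiagonal 2).over L) ⊓ unitaryGroupOfForm (conjMixed (↥(maximalRealSubfield L)) L (IsCMField.complexConj L)) 1)] :
    ∃ (νinf : Measure (UnitaryGroup.arch (↥(maximalRealSubfield L)) L (IsCMField.complexConj L) 2 ((StdForm.antidiagonal 2).over L))) (_ : IsHaarMeasure νinf) (_ : νinf.IsMulRightInvariant) (_ : νinf.IsInvInvariant) (_ : SFinite νinf)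
      (νf : Measure (finAdelic (↥(maximalRealSubfield L)) L (IsCMField.complexConj L) 2 ((StdForm.antidiagonal 2).over L))) (_ : IsHaarMeasure νf) (_ : IsFiniteMeasureOnCompacts νf) (_ : νf.IsMulLeftInvariant) (_ : νf.IsMulRightInvariant) (_ : νf.IsInvInvariant) (_ : νf.IsOpenPosMeasure)
      (μK : Measure ↥(UnitaryGroup.arch (↥(maximalRealSubfield L)) L (IsCMField.complexConj L) 2 ((StdForm.antidiagonal 2).over L) ⊓ unitaryGroupOfForm (conjMixed (↥(maximalRealSubfield L)) L (IsCMField.complexConj L)) 1)) (_ : IsHaarMeasure μK) (_ : IsProbabilityMeasure μK) (_ : μK.IsMulLeftInvariant) (_ : μK.IsMulRightInvariant) (_ : μK.IsInvInvariant)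
      (χ₁ : C_c(↥(UnitaryGroup.arch (↥(maximalRealSubfield L)) L (IsCMField.complexConj L) 2 ((StdForm.antidiagonal 2).over L) ⊓ unitaryGroupOfForm (conjMixed (↥(maximalRealSubfield L)) L (IsCMField.complexConj L)) 1), ℂ)) (_ : MeasurableMul (finAdelic (↥(maximalRealSubfield L)) L (IsCMField.complexConj L) 2 ((StdForm.antidiagonal 2).over L))), ∀ k, χ₁ k = 1 := by
  classical
  -- the archimedean Haar measure: unimodular, s-finite
  haveI := locallyCompactSpace_arch (↥(maximalRealSubfield L)) L (IsCMField.complexConj L) 2 ((StdForm.antidiagonal 2).over L)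
  haveI := secondCountableTopology_arch (↥(maximalRealSubfield L)) L (IsCMField.complexConj L) 2 ((StdForm.antidiagonal 2).over L)
  have hherm : (((StdForm.antidiagonal 2).over L).map (cmConjRingHom L)).transpose = (StdForm.antidiagonal 2).over L := by
    rw [StdForm.over_map, StdForm.transpose_over]
  have hdet : ((StdForm.antidiagonal 2).over L : Matrix (Fin 2) (Fin 2) L).det ≠ 0 :=
    ((Matrix.isUnit_iff_isUnit_det _).1 ((StdForm.antidiagonal 2).isUnit_over L)).ne_zero
  obtain ⟨νinf, hνinf, hνinfr⟩ := exists_isHaarMeasure_isMulRightInvariant_arch L ((StdForm.antidiagonal 2).over L) hherm hdet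
  haveI := hνinf
  haveI := hνinfr
  have hνinfinv : νinf.IsInvInvariant := isInvInvariant_of_isMulRightInvariant νinf
  -- the finite-adelic Haar measure: unimodular (read off the adelic group ★ `forall_isHaarMeasure_isMulRightInvariant_quasiSplit_cm_two`, any Borel structure on it)
  haveI := locallyCompactSpace_finAdelic (↥(maximalRealSubfield L)) L (IsCMField.complexConj L) 2 ((StdForm.antidiagonal 2).over L)
  haveI := secondCountableTopology_finAdelic (↥(maximalRealSubfield L)) L (IsCMField.complexConj L) 2 ((StdForm.antidiagonal 2).over L)
  haveI := t2Space_finAdelic (↥(maximalRealSubfield L)) L (IsCMField.complexConj L) 2 ((StdForm.antidiagonal 2).over L)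
  letI iQ : MeasurableSpace (quasiSplit (↥(maximalRealSubfield L)) L (IsCMField.complexConj L) 2).Adelic := borel _
  haveI iQB : BorelSpace (quasiSplit (↥(maximalRealSubfield L)) L (IsCMField.complexConj L) 2).Adelic := ⟨rfl⟩
  letI iQ' : MeasurableSpace (cmDatum L 2 ((StdForm.antidiagonal 2).over L)).Adelic := iQ
  haveI iQB' : BorelSpace (cmDatum L 2 ((StdForm.antidiagonal 2).over L)).Adelic := iQB
  have hUA : ∀ (ν : Measure (cmDatum L 2 ((StdForm.antidiagonal 2).over L)).Adelic) [IsHaarMeasure ν], ν.IsMulRightInvariant :=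
    fun ν hν => forall_isHaarMeasure_isMulRightInvariant_quasiSplit_cm_two L ν hν
  have hνfr : (haar : Measure (finAdelic (↥(maximalRealSubfield L)) L (IsCMField.complexConj L) 2 ((StdForm.antidiagonal 2).over L))).IsMulRightInvariant :=
    isMulRightInvariant_finAdelic_of_adelic L 2 ((StdForm.antidiagonal 2).over L) hUA haar
  have hνfinv : (haar : Measure (finAdelic (↥(maximalRealSubfield L)) L (IsCMField.complexConj L) 2 ((StdForm.antidiagonal 2).over L))).IsInvInvariant := isInvInvariant_of_isMulRightInvariant _
  -- the compact `K_∞ ∩ U(1⊗1)` and its normalised Haar measure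
  haveI := compactSpace_arch_inf_unitaryOne L 2 ((StdForm.antidiagonal 2).over L)
  haveI := secondCountableTopology_generalLinearGroup_mixedSpace L 2
  set μK : Measure ↥(UnitaryGroup.arch (↥(maximalRealSubfield L)) L (IsCMField.complexConj L) 2 ((StdForm.antidiagonal 2).over L) ⊓ unitaryGroupOfForm (conjMixed (↥(maximalRealSubfield L)) L (IsCMField.complexConj L)) 1) := haarMeasure ⊤ with hμK
  have hμK1 : IsProbabilityMeasure μK := ⟨by rw [hμK, ← TopologicalSpace.PositiveCompacts.coe_top]; exact haarMeasure_self⟩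
  have hμKr : μK.IsMulRightInvariant := isMulRightInvariant_of_compactSpace μK
  have hμKinv : μK.IsInvInvariant := isInvInvariant_of_compactSpace μK
  exact ⟨νinf, hνinf, hνinfr, hνinfinv, inferInstance, haar, inferInstance, inferInstance, inferInstance, hνfr, hνfinv, inferInstance, μK, inferInstance, hμK1, inferInstance, hμKr, hμKinv,
    ⟨ContinuousMap.const _ 1, HasCompactSupport.of_compactSpace _⟩, inferInstance, fun _ => rfl⟩

/-- **THE E1-SIDE STRUCTURAL BINDERS `νinf νf μK χ₁ e` (WITH `he0 he1 heK hestar hχ1`) OF THE TOP ROW ARE INHABITED** — the Borel σ-algebras by `borel _`, the measures and `χ₁ ≡ 1` of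
`exists_e1StructuralMeasures`, and the level idempotent `e = νf(K′_f)⁻¹·𝟙_{K′_f}` of the M1 finite level `K′_f = GL₂(𝒪̂_L) ∩ U(J₂)(𝔸_f)` (compact-open: ★ `m1_level_witness`, ★
`isCompact_of_isOpen_of_le_maximalLevelFin`; ★ `exists_levelIdempotent`). [cite: BorelJacquet1979, §4.1] [cite: Knapp2002, VIII §2 Cor. 8.31] [cite: DeitmarEchterhoff2014, Prop. 9.1.5] -/
theorem exists_e1StructuralBinders_top :
    ∃ (_ : MeasurableSpace (UnitaryGroup.arch (↥(maximalRealSubfield L)) L (IsCMField.complexConj L) 2 ((StdForm.antidiagonal 2).over L))) (_ : BorelSpace (UnitaryGroup.arch (↥(maximalRealSubfield L)) L (IsCMField.complexConj L) 2 ((StdForm.antidiagonal 2).over L))) (_ : MeasurableSpace (finAdelic (↥(maximalRealSubfield L)) L (IsCMField.complexConj L) 2 ((StdForm.antidiagonal 2).over L))) (_ : BorelSpace (finAdelic (↥(maximalRealSubfield L)) L (IsCMField.complexConj L) 2 ((StdForm.antidiagonal 2).over L)))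
      (νinf : Measure (UnitaryGroup.arch (↥(maximalRealSubfield L)) L (IsCMField.complexConj L) 2 ((StdForm.antidiagonal 2).over L))) (_ : IsHaarMeasure νinf) (_ : νinf.IsInvInvariant) (_ : SFinite νinf)
      (νf : Measure (finAdelic (↥(maximalRealSubfield L)) L (IsCMField.complexConj L) 2 ((StdForm.antidiagonal 2).over L))) (_ : IsFiniteMeasureOnCompacts νf) (_ : νf.IsMulLeftInvariant) (_ : νf.IsInvInvariant) (_ : νf.IsOpenPosMeasure)
      (_ : MeasurableSpace ↥(UnitaryGroup.arch (↥(maximalRealSubfield L)) L (IsCMField.complexConj L) 2 ((StdForm.antidiagonal 2).over L) ⊓ unitaryGroupOfForm (conjMixed (↥(maximalRealSubfield L)) L (IsCMField.complexConj L)) 1)) (_ : BorelSpace ↥(UnitaryGroup.arch (↥(maximalRealSubfield L)) L (IsCMField.complexConj L) 2 ((StdForm.antidiagonal 2).over L) ⊓ unitaryGroupOfForm (conjMixed (↥(maximalRealSubfield L)) L (IsCMField.complexConj L)) 1))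
      (μK : Measure ↥(UnitaryGroup.arch (↥(maximalRealSubfield L)) L (IsCMField.complexConj L) 2 ((StdForm.antidiagonal 2).over L) ⊓ unitaryGroupOfForm (conjMixed (↥(maximalRealSubfield L)) L (IsCMField.complexConj L)) 1)) (_ : IsProbabilityMeasure μK) (_ : μK.IsMulLeftInvariant) (_ : μK.IsMulRightInvariant) (_ : μK.IsInvInvariant)
      (χ₁ : C_c(↥(UnitaryGroup.arch (↥(maximalRealSubfield L)) L (IsCMField.complexConj L) 2 ((StdForm.antidiagonal 2).over L) ⊓ unitaryGroupOfForm (conjMixed (↥(maximalRealSubfield L)) L (IsCMField.complexConj L)) 1), ℂ)) (e : C_c(finAdelic (↥(maximalRealSubfield L)) L (IsCMField.complexConj L) 2 ((StdForm.antidiagonal 2).over L), ℂ)) (_ : MeasurableMul (finAdelic (↥(maximalRealSubfield L)) L (IsCMField.complexConj L) 2 ((StdForm.antidiagonal 2).over L))),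
      (∀ k, χ₁ k = 1) ∧ (∀ x, x ∉ ((glFiniteIntegralLevel 2 L).comap (finAdelic (↥(maximalRealSubfield L)) L (IsCMField.complexConj L) 2 ((StdForm.antidiagonal 2).over L)).subtype : Subgroup (finAdelic (↥(maximalRealSubfield L)) L (IsCMField.complexConj L) 2 ((StdForm.antidiagonal 2).over L))) → e x = 0) ∧ ∫ x, e x ∂νf = 1 ∧ (∀ k ∈ ((glFiniteIntegralLevel 2 L).comap (finAdelic (↥(maximalRealSubfield L)) L (IsCMField.complexConj L) 2 ((StdForm.antidiagonal 2).over L)).subtype : Subgroup (finAdelic (↥(maximalRealSubfield L)) L (IsCMField.complexConj L) 2 ((StdForm.antidiagonal 2).over L))), ∀ x, e (k * x) = e x) ∧ (∀ x, mulStar (⇑e) x = e x) := by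
  classical
  letI iA : MeasurableSpace (UnitaryGroup.arch (↥(maximalRealSubfield L)) L (IsCMField.complexConj L) 2 ((StdForm.antidiagonal 2).over L)) := borel _
  haveI iAB : BorelSpace (UnitaryGroup.arch (↥(maximalRealSubfield L)) L (IsCMField.complexConj L) 2 ((StdForm.antidiagonal 2).over L)) := ⟨rfl⟩
  letI iF : MeasurableSpace (finAdelic (↥(maximalRealSubfield L)) L (IsCMField.complexConj L) 2 ((StdForm.antidiagonal 2).over L)) := borel _
  haveI iFB : BorelSpace (finAdelic (↥(maximalRealSubfield L)) L (IsCMField.complexConj L) 2 ((StdForm.antidiagonal 2).over L)) := ⟨rfl⟩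
  letI iK : MeasurableSpace ↥(UnitaryGroup.arch (↥(maximalRealSubfield L)) L (IsCMField.complexConj L) 2 ((StdForm.antidiagonal 2).over L) ⊓ unitaryGroupOfForm (conjMixed (↥(maximalRealSubfield L)) L (IsCMField.complexConj L)) 1) := borel _
  haveI iKB : BorelSpace ↥(UnitaryGroup.arch (↥(maximalRealSubfield L)) L (IsCMField.complexConj L) 2 ((StdForm.antidiagonal 2).over L) ⊓ unitaryGroupOfForm (conjMixed (↥(maximalRealSubfield L)) L (IsCMField.complexConj L)) 1) := ⟨rfl⟩
  obtain ⟨νinf, hνinf, -, hνinfinv, hνinfsf, νf, hνf, hνfc, hνfl, -, hνfinv, hνfo, μK, -, hμK1, hμKl, hμKr, hμKinv, χ₁, iFM, hχ1⟩ := exists_e1StructuralMeasures L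
  -- the level idempotent of the M1 finite level
  obtain ⟨-, -, hU₀Kc, -, hK'o, -, -⟩ := m1_level_witness L
  obtain ⟨e, he0, he1, heK, hestar⟩ := exists_levelIdempotent νf hK'o
    (isCompact_of_isOpen_of_le_maximalLevelFin (↥(maximalRealSubfield L)) L (IsCMField.complexConj L) 2 hK'o fun b hb => Subgroup.mem_comap.2 (hU₀Kc b hb))
  exact ⟨iA, iAB, iF, iFB, νinf, hνinf, hνinfinv, hνinfsf, νf, hνfc, hνfl, hνfinv, hνfo, iK, iKB, μK, hμK1, hμKl, hμKr, hμKinv, χ₁, e, iFM, hχ1, he0, he1, heK, hestar⟩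

/-! ## §2 The top-row (N_blk) heads OF RECORD: ★ p865127 (self-dual) and ★ OD §4 (off-dual), binder-free -/

/-- **(N_blk)-SD AT THE TOP ROW, OF RECORD** — ★ p865127 `exists_blockModel_subrep_le_orthogonal_resHLine_selfDual_maximalLevel`'s conclusion VERBATIM with every structural binder
discharged (§1; the Borel σ-algebra of `U(J₂)(𝔸)` by `borel _`): for a self-dual block `χ` of maximal level there is a rung-1 coordinate map `V : L² →ₗ A × L²(m)`, injective on
`resHBlock L μ K 1 χ`, with every topologically irreducible closed `W′ ≤ L²` orthogonal to the pure line part `resHLine L μ V K 1 χ`.  Visible: `(L, μ)` and the block datum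
`(χ, hray, hsd, hne)` only. [cite: MoeglinWaldspurger1995, II.2.4, IV.1.10, V.3.13, VI.2] [cite: BorelJacquet1979, §4.1] -/
theorem exists_blockModel_subrep_le_orthogonal_resHLine_selfDual_top_of_record
    {χ : HeckeCharacter L} (hray : ∀ r : ℝ≥0ˣ, χ (posRealIdele L r) = 1) (hsd : reflectChar (IsCMField.complexConj L) χ = χ)
    (hne : chiSectionSpace χ ((standardMaximalCompactGL 2 L).comap (adelicVal (↥(maximalRealSubfield L)) L (IsCMField.complexConj L) 2 ((StdForm.antidiagonal 2).over L)) : Subgroup (quasiSplit (↥(maximalRealSubfield L)) L (IsCMField.complexConj L) 2).Adelic) 1 ≠ ⊥) :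
    ∃ (A : Type) (_ : AddCommGroup A) (_ : Module ℂ A) (_ : FiniteDimensional ℂ A) (Ω : Type) (_ : MeasurableSpace Ω) (m : Measure Ω)
      (E : Type) (_ : NormedAddCommGroup E) (_ : NormedSpace ℂ E) (V : (quasiSplit (↥(maximalRealSubfield L)) L (IsCMField.complexConj L) 2).L2 μ →ₗ[ℂ] (A × Lp E 2 m)),
      (∀ y ∈ resHBlock L μ ((standardMaximalCompactGL 2 L).comap (adelicVal (↥(maximalRealSubfield L)) L (IsCMField.complexConj L) 2 ((StdForm.antidiagonal 2).over L)) : Subgroup (quasiSplit (↥(maximalRealSubfield L)) L (IsCMField.complexConj L) 2).Adelic) 1 χ, V y = 0 → y = 0) ∧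
      ∀ W' : ClosedSubrep ((quasiSplit (↥(maximalRealSubfield L)) L (IsCMField.complexConj L) 2).rightRegular μ), W'.toContRep.IsTopIrreducible →
        W'.toSubmodule ≤ (resHLine L μ V ((standardMaximalCompactGL 2 L).comap (adelicVal (↥(maximalRealSubfield L)) L (IsCMField.complexConj L) 2 ((StdForm.antidiagonal 2).over L)) : Subgroup (quasiSplit (↥(maximalRealSubfield L)) L (IsCMField.complexConj L) 2).Adelic) 1 χ)ᗮ := by
  classical
  letI : MeasurableSpace (quasiSplit (↥(maximalRealSubfield L)) L (IsCMField.complexConj L) 2).Adelic := borel _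
  haveI : BorelSpace (quasiSplit (↥(maximalRealSubfield L)) L (IsCMField.complexConj L) 2).Adelic := ⟨rfl⟩
  obtain ⟨iA, iAB, iF, iFB, νinf, hνinf, hνinfinv, hνinfsf, νf, hνf₁, hνf₂, hνf₃, hνf₄, iK, iKB, μK, hμK₁, hμK₂, hμK₃, hμK₄, χ₁, e, iFM, hχ1, he0, he1, heK, hestar⟩ :=
    exists_e1StructuralBinders_top L
  exact exists_blockModel_subrep_le_orthogonal_resHLine_selfDual_maximalLevel L μ νinf νf μK χ₁ e hχ1 he0 he1 heK hestar hray hsd hne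

/-- **(N_blk)-SD AT THE TOP ROW IN `hN` BYTES, OF RECORD** — ★ p865127 `exists_blockModel_resH_isotypic_le_orthogonal_lines_selfDual_maximalLevel` binder-free: the `hN` row of ★ p862113 at
`(K, 1, resHLine L μ V K 1 χ)` for the rung-1 SD coordinate map `V` (∃-bound with its injectivity on the block). [cite: MoeglinWaldspurger1995, IV.1.10, V.3.13, VI.2] -/
theorem exists_blockModel_resH_isotypic_le_orthogonal_lines_selfDual_top_of_record
    {χ : HeckeCharacter L} (hray : ∀ r : ℝ≥0ˣ, χ (posRealIdele L r) = 1) (hsd : reflectChar (IsCMField.complexConj L) χ = χ)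
    (hne : chiSectionSpace χ ((standardMaximalCompactGL 2 L).comap (adelicVal (↥(maximalRealSubfield L)) L (IsCMField.complexConj L) 2 ((StdForm.antidiagonal 2).over L)) : Subgroup (quasiSplit (↥(maximalRealSubfield L)) L (IsCMField.complexConj L) 2).Adelic) 1 ≠ ⊥)
    (𝔓 : (quasiSplit (↥(maximalRealSubfield L)) L (IsCMField.complexConj L) 2).ParabolicUnipotentData) :
    ∃ (A : Type) (_ : AddCommGroup A) (_ : Module ℂ A) (_ : FiniteDimensional ℂ A) (Ω : Type) (_ : MeasurableSpace Ω) (m : Measure Ω)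
      (E : Type) (_ : NormedAddCommGroup E) (_ : NormedSpace ℂ E) (V : (quasiSplit (↥(maximalRealSubfield L)) L (IsCMField.complexConj L) 2).L2 μ →ₗ[ℂ] (A × Lp E 2 m)),
      (∀ y ∈ resHBlock L μ ((standardMaximalCompactGL 2 L).comap (adelicVal (↥(maximalRealSubfield L)) L (IsCMField.complexConj L) 2 ((StdForm.antidiagonal 2).over L)) : Subgroup (quasiSplit (↥(maximalRealSubfield L)) L (IsCMField.complexConj L) 2).Adelic) 1 χ, V y = 0 → y = 0) ∧
      ∀ W' : ClosedSubrep ((quasiSplit (↥(maximalRealSubfield L)) L (IsCMField.complexConj L) 2).rightRegular μ), W'.toContRep.IsTopIrreducible → W' ≤ residualSubspace (quasiSplit (↥(maximalRealSubfield L)) L (IsCMField.complexConj L) 2) μ 𝔓 →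
        W'.toSubmodule ⊓ (⨅ k : ↥((standardMaximalCompactGL 2 L).comap (adelicVal (↥(maximalRealSubfield L)) L (IsCMField.complexConj L) 2 ((StdForm.antidiagonal 2).over L)) : Subgroup (quasiSplit (↥(maximalRealSubfield L)) L (IsCMField.complexConj L) 2).Adelic), Module.End.eigenspace ((((quasiSplit (↥(maximalRealSubfield L)) L (IsCMField.complexConj L) 2).rightRegular μ) ((((standardMaximalCompactGL 2 L).comap (adelicVal (↥(maximalRealSubfield L)) L (IsCMField.complexConj L) 2 ((StdForm.antidiagonal 2).over L)) : Subgroup (quasiSplit (↥(maximalRealSubfield L)) L (IsCMField.complexConj L) 2).Adelic)).subtype k) : (quasiSplit (↥(maximalRealSubfield L)) L (IsCMField.complexConj L) 2).L2 μ →L[ℂ] (quasiSplit (↥(maximalRealSubfield L)) L (IsCMField.complexConj L) 2).L2 μ) : (quasiSplit (↥(maximalRealSubfield L)) L (IsCMField.complexConj L) 2).L2 μ →ₗ[ℂ] (quasiSplit (↥(maximalRealSubfield L)) L (IsCMField.complexConj L) 2).L2 μ) ((1 : ↥((standardMaximalCompactGL 2 L).comap (adelicVal (↥(maximalRealSubfield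 L)) L (IsCMField.complexConj L) 2 ((StdForm.antidiagonal 2).over L)) : Subgroup (quasiSplit (↥(maximalRealSubfield L)) L (IsCMField.complexConj L) 2).Adelic) →* ℂ) k)) ≤
          (resHLine L μ V ((standardMaximalCompactGL 2 L).comap (adelicVal (↥(maximalRealSubfield L)) L (IsCMField.complexConj L) 2 ((StdForm.antidiagonal 2).over L)) : Subgroup (quasiSplit (↥(maximalRealSubfield L)) L (IsCMField.complexConj L) 2).Adelic) 1 χ)ᗮ := by
  classical
  letI : MeasurableSpace (quasiSplit (↥(maximalRealSubfield L)) L (IsCMField.complexConj L) 2).Adelic := borel _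
  haveI : BorelSpace (quasiSplit (↥(maximalRealSubfield L)) L (IsCMField.complexConj L) 2).Adelic := ⟨rfl⟩
  obtain ⟨iA, iAB, iF, iFB, νinf, hνinf, hνinfinv, hνinfsf, νf, hνf₁, hνf₂, hνf₃, hνf₄, iK, iKB, μK, hμK₁, hμK₂, hμK₃, hμK₄, χ₁, e, iFM, hχ1, he0, he1, heK, hestar⟩ :=
    exists_e1StructuralBinders_top L
  exact exists_blockModel_resH_isotypic_le_orthogonal_lines_selfDual_maximalLevel L μ νinf νf μK χ₁ e hχ1 he0 he1 heK hestar hray hsd hne 𝔓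

/-- **(N_blk)-SD AT THE TOP ROW IN `Iso` BYTES, RESIDUAL-FREE, OF RECORD** (K2E3-p27 (g4)'s ask for UB-PK-2b: the row is residual-free): the same `hN` row WITHOUT the parabolic datum `𝔓`
and the premise `W′ ≤ L²_res` — for every topologically irreducible closed `W′ ≤ L²`, `W′ ⊓ Iso(K, 1) ⟂ resHLine L μ V K 1 χ` (from the `_subrep_` head by `inf_le_left`).
[cite: MoeglinWaldspurger1995, IV.1.10, V.3.13, VI.2] -/
theorem exists_blockModel_isotypic_le_orthogonal_resHLine_selfDual_top_of_record
    {χ : HeckeCharacter L} (hray : ∀ r : ℝ≥0ˣ, χ (posRealIdele L r) = 1) (hsd : reflectChar (IsCMField.complexConj L) χ = χ)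
    (hne : chiSectionSpace χ ((standardMaximalCompactGL 2 L).comap (adelicVal (↥(maximalRealSubfield L)) L (IsCMField.complexConj L) 2 ((StdForm.antidiagonal 2).over L)) : Subgroup (quasiSplit (↥(maximalRealSubfield L)) L (IsCMField.complexConj L) 2).Adelic) 1 ≠ ⊥) :
    ∃ (A : Type) (_ : AddCommGroup A) (_ : Module ℂ A) (_ : FiniteDimensional ℂ A) (Ω : Type) (_ : MeasurableSpace Ω) (m : Measure Ω)
      (E : Type) (_ : NormedAddCommGroup E) (_ : NormedSpace ℂ E) (V : (quasiSplit (↥(maximalRealSubfield L)) L (IsCMField.complexConj L) 2).L2 μ →ₗ[ℂ] (A × Lp E 2 m)),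
      (∀ y ∈ resHBlock L μ ((standardMaximalCompactGL 2 L).comap (adelicVal (↥(maximalRealSubfield L)) L (IsCMField.complexConj L) 2 ((StdForm.antidiagonal 2).over L)) : Subgroup (quasiSplit (↥(maximalRealSubfield L)) L (IsCMField.complexConj L) 2).Adelic) 1 χ, V y = 0 → y = 0) ∧
      ∀ W' : ClosedSubrep ((quasiSplit (↥(maximalRealSubfield L)) L (IsCMField.complexConj L) 2).rightRegular μ), W'.toContRep.IsTopIrreducible →
        W'.toSubmodule ⊓ (⨅ k : ↥((standardMaximalCompactGL 2 L).comap (adelicVal (↥(maximalRealSubfield L)) L (IsCMField.complexConj L) 2 ((StdForm.antidiagonal 2).over L)) : Subgroup (quasiSplit (↥(maximalRealSubfield L)) L (IsCMField.complexConj L) 2).Adelic), Module.End.eigenspace ((((quasiSplit (↥(maximalRealSubfield L)) L (IsCMField.complexConj L) 2).rightRegular μ) ((((standardMaximalCompactGL 2 L).comap (adelicVal (↥(maximalRealSubfield L)) L (IsCMField.complexConj L) 2 ((StdForm.antidiagonal 2).over L)) : Subgroup (quasiSplit (↥(maximalRealSubfield L)) L (IsCMField.complexConj L) 2).Adelic)).subtype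 k) : (quasiSplit (↥(maximalRealSubfield L)) L (IsCMField.complexConj L) 2).L2 μ →L[ℂ] (quasiSplit (↥(maximalRealSubfield L)) L (IsCMField.complexConj L) 2).L2 μ) : (quasiSplit (↥(maximalRealSubfield L)) L (IsCMField.complexConj L) 2).L2 μ →ₗ[ℂ] (quasiSplit (↥(maximalRealSubfield L)) L (IsCMField.complexConj L) 2).L2 μ) ((1 : ↥((standardMaximalCompactGL 2 L).comap (adelicVal (↥(maximalRealSubfield L)) L (IsCMField.complexConj L) 2 ((StdForm.antidiagonal 2).over L)) : Subgroup (quasiSplit (↥(maximalRealSubfield L)) L (IsCMField.complexConj L) 2).Adelic) →* ℂ) k)) ≤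
          (resHLine L μ V ((standardMaximalCompactGL 2 L).comap (adelicVal (↥(maximalRealSubfield L)) L (IsCMField.complexConj L) 2 ((StdForm.antidiagonal 2).over L)) : Subgroup (quasiSplit (↥(maximalRealSubfield L)) L (IsCMField.complexConj L) 2).Adelic) 1 χ)ᗮ := by
  obtain ⟨A, iA₁, iA₂, iA₃, Ω, iΩ, m, E, iE₁, iE₂, V, hVinj, hW⟩ := exists_blockModel_subrep_le_orthogonal_resHLine_selfDual_top_of_record L μ hray hsd hne
  exact ⟨A, iA₁, iA₂, iA₃, Ω, iΩ, m, E, iE₁, iE₂, V, hVinj, fun W' hW' => inf_le_left.trans (hW W' hW')⟩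

/-- **THE OFF-DUAL BLOCK OF MAXIMAL LEVEL CARRIES NO DISCRETE MASS, OF RECORD** — ★ `subrep_le_orthogonal_resHBlock_offDual_maximalLevel` (file `R90S8ResHOffDualNoLineMassU2`, §4) with
every structural binder discharged (§1): for every unitary off-dual `χ` and every topologically irreducible closed `W′ ≤ L²`, `W′ ⟂ resHBlock L μ K 1 χ`.  Visible: `(L, μ)` and
`(χ, hχu, hoff)` only. [cite: MoeglinWaldspurger1995, IV.1.10, IV.3.12, VI.2] [cite: BorelJacquet1979, §4.1] -/
theorem subrep_le_orthogonal_resHBlock_offDual_top_of_record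
    {χ : HeckeCharacter L} (hχu : χ.IsUnitary) (hoff : ¬ (χ * (reflectChar (IsCMField.complexConj L) χ)⁻¹).IsNormTwist) :
    ∀ W' : ClosedSubrep ((quasiSplit (↥(maximalRealSubfield L)) L (IsCMField.complexConj L) 2).rightRegular μ), W'.toContRep.IsTopIrreducible → W'.toSubmodule ≤ (resHBlock L μ ((standardMaximalCompactGL 2 L).comap (adelicVal (↥(maximalRealSubfield L)) L (IsCMField.complexConj L) 2 ((StdForm.antidiagonal 2).over L)) : Subgroup (quasiSplit (↥(maximalRealSubfield L)) L (IsCMField.complexConj L) 2).Adelic) 1 χ)ᗮ := by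
  classical
  letI : MeasurableSpace (quasiSplit (↥(maximalRealSubfield L)) L (IsCMField.complexConj L) 2).Adelic := borel _
  haveI : BorelSpace (quasiSplit (↥(maximalRealSubfield L)) L (IsCMField.complexConj L) 2).Adelic := ⟨rfl⟩
  obtain ⟨iA, iAB, iF, iFB, νinf, hνinf, hνinfinv, hνinfsf, νf, hνf₁, hνf₂, hνf₃, hνf₄, iK, iKB, μK, hμK₁, hμK₂, hμK₃, hμK₄, χ₁, e, iFM, hχ1, he0, he1, heK, hestar⟩ :=
    exists_e1StructuralBinders_top L
  exact subrep_le_orthogonal_resHBlock_offDual_maximalLevel L μ νinf νf μK χ₁ e hχ1 he0 he1 heK hestar hχu hoff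

/-- **(N_blk) AT THE MAXIMAL LEVEL, `ω = 1`, OFF-DUAL `χ`, OF RECORD** — ★ `resH_isotypic_le_orthogonal_lines_offDual_maximalLevel` binder-free: the `hN` bytes at `(K, 1, resHLine L μ U′ K 1 χ)`
for every block-model map `U′`. [cite: MoeglinWaldspurger1995, IV.1.10, V.3.13, VI.2] -/
theorem resH_isotypic_le_orthogonal_lines_offDual_top_of_record
    {χ : HeckeCharacter L} (hχu : χ.IsUnitary) (hoff : ¬ (χ * (reflectChar (IsCMField.complexConj L) χ)⁻¹).IsNormTwist)
    (𝔓 : (quasiSplit (↥(maximalRealSubfield L)) L (IsCMField.complexConj L) 2).ParabolicUnipotentData)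
    {A Λ : Type*} [AddCommGroup A] [Module ℂ A] [AddCommGroup Λ] [Module ℂ Λ] (U' : (quasiSplit (↥(maximalRealSubfield L)) L (IsCMField.complexConj L) 2).L2 μ →ₗ[ℂ] A × Λ) :
    ∀ W' : ClosedSubrep ((quasiSplit (↥(maximalRealSubfield L)) L (IsCMField.complexConj L) 2).rightRegular μ), W'.toContRep.IsTopIrreducible → W' ≤ residualSubspace (quasiSplit (↥(maximalRealSubfield L)) L (IsCMField.complexConj L) 2) μ 𝔓 →
      W'.toSubmodule ⊓ (⨅ k : ↥((standardMaximalCompactGL 2 L).comap (adelicVal (↥(maximalRealSubfield L)) L (IsCMField.complexConj L) 2 ((StdForm.antidiagonal 2).over L)) : Subgroup (quasiSplit (↥(maximalRealSubfield L)) L (IsCMField.complexConj L) 2).Adelic), Module.End.eigenspace ((((quasiSplit (↥(maximalRealSubfield L)) L (IsCMField.complexConj L) 2).rightRegular μ) ((((standardMaximalCompactGL 2 L).comap (adelicVal (↥(maximalRealSubfield L)) L (IsCMField.complexConj L) 2 ((StdForm.antidiagonal 2).over L)) : Subgroup (quasiSplit (↥(maximalRealSubfield L)) L (IsCMField.complexConj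 L) 2).Adelic)).subtype k) : (quasiSplit (↥(maximalRealSubfield L)) L (IsCMField.complexConj L) 2).L2 μ →L[ℂ] (quasiSplit (↥(maximalRealSubfield L)) L (IsCMField.complexConj L) 2).L2 μ) : (quasiSplit (↥(maximalRealSubfield L)) L (IsCMField.complexConj L) 2).L2 μ →ₗ[ℂ] (quasiSplit (↥(maximalRealSubfield L)) L (IsCMField.complexConj L) 2).L2 μ) ((1 : ↥((standardMaximalCompactGL 2 L).comap (adelicVal (↥(maximalRealSubfield L)) L (IsCMField.complexConj L) 2 ((StdForm.antidiagonal 2).over L)) : Subgroup (quasiSplit (↥(maximalRealSubfield L)) L (IsCMField.complexConj L) 2).Adelic) →* ℂ) k)) ≤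
        (resHLine L μ U' ((standardMaximalCompactGL 2 L).comap (adelicVal (↥(maximalRealSubfield L)) L (IsCMField.complexConj L) 2 ((StdForm.antidiagonal 2).over L)) : Subgroup (quasiSplit (↥(maximalRealSubfield L)) L (IsCMField.complexConj L) 2).Adelic) 1 χ)ᗮ := by
  classical
  letI : MeasurableSpace (quasiSplit (↥(maximalRealSubfield L)) L (IsCMField.complexConj L) 2).Adelic := borel _
  haveI : BorelSpace (quasiSplit (↥(maximalRealSubfield L)) L (IsCMField.complexConj L) 2).Adelic := ⟨rfl⟩
  obtain ⟨iA, iAB, iF, iFB, νinf, hνinf, hνinfinv, hνinfsf, νf, hνf₁, hνf₂, hνf₃, hνf₄, iK, iKB, μK, hμK₁, hμK₂, hμK₃, hμK₄, χ₁, e, iFM, hχ1, he0, he1, heK, hestar⟩ :=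
    exists_e1StructuralBinders_top L
  exact resH_isotypic_le_orthogonal_lines_offDual_maximalLevel L μ νinf νf μK χ₁ e hχ1 he0 he1 heK hestar hχu hoff 𝔓 U'

end Summit.HodgeConjecture.HodgeConjecture.R90.S8

end
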